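/-
Origin: expansion seat `planner-pub-hodgecm-prl1-0`, handover v5 2026-08-18T03:33:51Z (`HOME/pub-hodgecm-prl1/lean/Prl1/LineField.lean`, md5 0e0967ae, 137 lines);
landed by the gen-5 packager in gate run 18 as `HodgeCM/Proofs/LineField.lean` (verbatim).
-/
/-
Origin: HOME/pub-hodgecm-prl1/lean/Prl1/LineField.lean — session planner-pub-hodgecm-prl1-0 (unit pub-hodgecm-prl1).
Intended final place: `HodgeCM/Proofs/LineField.lean` (Mathlib only).  Pure topology / linear algebra, 0 hypotheses
beyond the abstract setting: the group-theoretic core of PerL v5 Prop 4.3 (`prop:S12`, tex ll. 639–684), PROVED,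
in a form SIMPLER than the tex (no line sub-bundle, no continuity of the line field, no `2 × 2` minors of `𝒰₂`).
-/
import Mathlib.Analysis.Complex.Basic
import Mathlib.LinearAlgebra.Matrix.NonsingularInverse
import Mathlib.Topology.Algebra.MulAction
import Mathlib.Topology.Instances.Matrix

set_option autoImplicit false

/-!
# The line-field lemma (abstract core of PerL v5 Proposition 4.3)

**Setting.** A topological group(oid) `Gr` acting continuously and TRANSITIVELY on a space `Pt` (think
`U(2,1) ↷ 𝔹²`), a DENSE subset `Δ ⊆ Gr` (the image of `G_U(L₀)`, dense by real approximation), an "automorphy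
factor" `J : Gr → Pt → Matrix (Fin 2) (Fin 2) ℂ` (think `ᵗ(dγ)_x` in a trivialisation of `T^*𝔹²`), continuous in
`γ` and invertible, whose isotropy values move every line (`irred`: for `v ≠ 0` some `k ∈ Stab(x)` has
`J k x v ∦ v` — for the ball: `K_x ≅ U(2) × U(1)` acts through the twisted standard representation and `SU(2)` is
transitive on the lines of `ℂ²`), and two sets `𝒰₁, 𝒰₂` of continuous "one-forms" `Pt → ℂ²` stable under the
translates `u ↦ (x ↦ J γ x · u(γ x))`, `γ ∈ Δ` (Hecke translates of theta forms are theta forms).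

**Lemma (`lineField_false`).** If both `𝒰ᵢ` contain a nonzero form and every pointwise wedge
`u₁(x) ∧ u₂(x)` (`u_i ∈ 𝒰_i`) vanishes, contradiction.

**Proof (shorter than the tex).** Pick `u₁ ∈ 𝒰₁` and `x₁` with `u₁(x₁) ≠ 0`.  Some `u₂ ∈ 𝒰₂` has `u₂(x₁) ≠ 0`:
otherwise every `u ∈ 𝒰₂` vanishes on `Δ · x₁` (translates, `J` invertible), a dense subset of `Gr · x₁ = Pt`, so
`u = 0`.  For `γ ∈ Δ` the translate `γ^*u₁ ∈ 𝒰₁` satisfies `(γ^*u₁)(x₁) ∧ u₂(x₁) = 0 = u₁(x₁) ∧ u₂(x₁)` with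
`u₂(x₁) ≠ 0`, hence `J γ x₁ · u₁(γ x₁) ∥ u₁(x₁)`.  This closed condition on `γ` holds on the dense `Δ`, so for all
`γ ∈ Gr`; at an isotropy element `k` of `x₁` it says `J k x₁ · u₁(x₁) ∥ u₁(x₁)`, contradicting `irred`.
-/

noncomputable section

open Matrix

namespace HodgeCM

namespace LineField

/-- The `2 × 2` wedge `v ∧ w = v₀ w₁ − v₁ w₀` of two vectors of `ℂ²`. -/
def wedge2 (v w : Fin 2 → ℂ) : ℂ := v 0 * w 1 - v 1 * w 0

/-- (Ported verbatim from the HodgeCMPerL package; no docstring in the source.) -/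
theorem wedge2_self (v : Fin 2 → ℂ) : wedge2 v v = 0 := by unfold wedge2; ring

/-- (Ported verbatim from the HodgeCMPerL package; no docstring in the source.) -/
theorem wedge2_swap (v w : Fin 2 → ℂ) : wedge2 w v = -wedge2 v w := by unfold wedge2; ring

/-- Two vectors each parallel to a NONZERO `w` are parallel to each other. -/
theorem wedge2_trans {v v' w : Fin 2 → ℂ} (hv : wedge2 v w = 0) (hv' : wedge2 v' w = 0) (hw : w ≠ 0) :
    wedge2 v' v = 0 := by
  unfold wedge2 at *
  by_cases h1 : w 1 = 0
  · have h0 : w 0 ≠ 0 := by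
      intro h0; apply hw; funext i; fin_cases i <;> simp [h0, h1]
    rw [h1, mul_zero, zero_sub, neg_eq_zero, mul_eq_zero] at hv hv'
    rcases hv with hv | hv
    · rcases hv' with hv' | hv'
      · rw [hv, hv']; ring
      · exact absurd hv' h0
    · exact absurd hv h0
  · have e : v 0 = v 1 * w 0 / w 1 := by field_simp; linear_combination hv
    have e' : v' 0 = v' 1 * w 0 / w 1 := by field_simp; linear_combination hv'
    rw [e, e']; field_simp; ring

/-- Continuity of the wedge of two continuous vector-valued maps. -/
theorem continuous_wedge2 {X : Type*} [TopologicalSpace X] {A B : X → Fin 2 → ℂ} (hA : Continuous A)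
    (hB : Continuous B) : Continuous fun x => wedge2 (A x) (B x) := by
  unfold wedge2
  fun_prop

/-- A closed condition holding on a dense set holds everywhere. -/
theorem forall_of_dense {Gr : Type*} [TopologicalSpace Gr] {Δ : Set Gr} (hΔ : Dense Δ) {C : Set Gr}
    (hC : IsClosed C) (h : Δ ⊆ C) (g : Gr) : g ∈ C := by
  have hc : closure Δ ⊆ C := hC.closure_subset_iff.mpr h
  rw [hΔ.closure_eq] at hc
  exact hc (Set.mem_univ g)

variable {Pt Gr : Type*} [TopologicalSpace Pt] [TopologicalSpace Gr] [Group Gr] [MulAction Gr Pt]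
  [ContinuousSMul Gr Pt]

/-- **The line-field lemma** (abstract core of PerL v5 Prop 4.3; see the module docstring for the dictionary and
the proof). -/
theorem lineField_false (Δ : Set Gr) (hΔ : Dense Δ) (J : Gr → Pt → Matrix (Fin 2) (Fin 2) ℂ)
    (hJ : ∀ x : Pt, Continuous fun g : Gr => J g x) (hJu : ∀ (g : Gr) (x : Pt), IsUnit (J g x))
    (trans : ∀ x y : Pt, ∃ g : Gr, g • x = y)
    (irred : ∀ (x : Pt) (v : Fin 2 → ℂ), v ≠ 0 → ∃ k : Gr, k • x = x ∧ wedge2 (J k x *ᵥ v) v ≠ 0)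
    (𝒰₁ 𝒰₂ : Set (Pt → Fin 2 → ℂ)) (cont₁ : ∀ u ∈ 𝒰₁, Continuous u) (cont₂ : ∀ u ∈ 𝒰₂, Continuous u)
    (transl₁ : ∀ γ ∈ Δ, ∀ u ∈ 𝒰₁, (fun x => J γ x *ᵥ u (γ • x)) ∈ 𝒰₁)
    (transl₂ : ∀ γ ∈ Δ, ∀ u ∈ 𝒰₂, (fun x => J γ x *ᵥ u (γ • x)) ∈ 𝒰₂)
    (ne₁ : ∃ u ∈ 𝒰₁, u ≠ 0) (ne₂ : ∃ u ∈ 𝒰₂, u ≠ 0)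
    (wedge : ∀ u₁ ∈ 𝒰₁, ∀ u₂ ∈ 𝒰₂, ∀ x : Pt, wedge2 (u₁ x) (u₂ x) = 0) : False := by
  classical
  -- a form of type 1 and a point where it does not vanish
  obtain ⟨u₁, hu₁, hne₁⟩ := ne₁
  obtain ⟨x₁, hx₁⟩ : ∃ x, u₁ x ≠ 0 := by
    by_contra h; push Not at h; exact hne₁ (funext fun x => by simpa using h x)
  -- orbit maps and translates are continuous
  have orb : ∀ x : Pt, Continuous fun g : Gr => g • x := fun x => continuous_id.smul continuous_const
  -- some form of type 2 does not vanish at x₁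
  obtain ⟨u₂, hu₂, hx₂⟩ : ∃ u ∈ 𝒰₂, u x₁ ≠ 0 := by
    by_contra hall
    push Not at hall
    obtain ⟨u, hu, hne⟩ := ne₂
    apply hne
    funext y
    -- `u` vanishes on the dense orbit `Δ · x₁`, hence at `y = g · x₁`
    have hC : IsClosed {g : Gr | u (g • x₁) = 0} :=
      isClosed_eq ((cont₂ u hu).comp (orb x₁)) continuous_const
    have hsub : Δ ⊆ {g : Gr | u (g • x₁) = 0} := by
      intro γ hγ
      have h0 : J γ x₁ *ᵥ u (γ • x₁) = 0 := hall _ (transl₂ γ hγ u hu)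
      have hinj := (mulVec_injective_iff_isUnit (A := J γ x₁)).mpr (hJu γ x₁)
      exact hinj (by rw [h0, mulVec_zero])
    obtain ⟨g, rfl⟩ := trans x₁ y
    simpa using forall_of_dense hΔ hC hsub g
  -- the closed condition `J g x₁ · u₁(g x₁) ∥ u₁(x₁)` holds on Δ, hence everywhere
  have hC : IsClosed {g : Gr | wedge2 (J g x₁ *ᵥ u₁ (g • x₁)) (u₁ x₁) = 0} :=
    isClosed_eq (continuous_wedge2 ((hJ x₁).matrix_mulVec ((cont₁ u₁ hu₁).comp (orb x₁)))
      continuous_const) continuous_const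
  have hsub : Δ ⊆ {g : Gr | wedge2 (J g x₁ *ᵥ u₁ (g • x₁)) (u₁ x₁) = 0} := by
    intro γ hγ
    have h1 : wedge2 (J γ x₁ *ᵥ u₁ (γ • x₁)) (u₂ x₁) = 0 := wedge _ (transl₁ γ hγ u₁ hu₁) u₂ hu₂ x₁
    have h2 : wedge2 (u₁ x₁) (u₂ x₁) = 0 := wedge u₁ hu₁ u₂ hu₂ x₁
    exact wedge2_trans h2 h1 hx₂
  -- at an isotropy element this contradicts irreducibility
  obtain ⟨k, hk, hkv⟩ := irred x₁ (u₁ x₁) hx₁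
  have := forall_of_dense hΔ hC hsub k
  simp only [Set.mem_setOf_eq, hk] at this
  exact hkv this

end LineField

end HodgeCM

end
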